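import Literature.InformationTheory.QuantumCodes.SubsystemCodes
import Literature.InformationTheory.QuantumCodes.LocalCodeDistanceBoundPeriodic
import HarnessLib

/-!
# Bravyi–Terhal 2009, Proposition 2 / Theorem 1* on the torus (`L ≥ 2(r−1)²`) — proof

S. Bravyi, B. Terhal, arXiv:0810.1983 [BravyiTerhal2009], §3.3 Proposition 2 (chunk p0013 L100–112): «Let `𝒢` be a
subsystem code on a lattice `Λ = {1,…,L}^D` with open or periodic boundary conditions. Assume that a stabilizer
group `𝒮 = 𝒢 ∩ 𝒞(𝒢)` has local generators, `𝒮 = ⟨S_1,…,S_m⟩`, such that the support of any generator `S_a` can be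
covered by a hypercube with `r^D` vertices. Then `d_1(𝒢) ≤ r` for any `L ≥ 2(r−1)²`.» and «Theorems 1* and 2* are
direct corollaries of Proposition 2 … the weight of `P` is at most `rL^{D−1}`, that is, `d(𝒢) ≤ rL^{D−1}`» (p0014
L20–24).

THIS FILE PROVES the PERIODIC case of Theorem 1* (the open case is `SubsystemCodeDistanceBound.lean`):
`BravyiTerhal2009_theorem1_star_periodic : 1 ≤ D → 1 ≤ r → 2(r−1)² ≤ L → HasLocalGeneratorsPeriodic e r (gaugeStabilizer Ḡ)
→ IsSubsystemCode Ḡ k d → 1 ≤ k → d ≤ r · L^{D−1}` — for `Ḡ` self-orthogonal this is the tree's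
`BravyiTerhal2009_thm1_periodic_holds` (`LocalCodeDistanceBoundPeriodic.lean`), whose balanced slab partition of the
circle (`exists_slabBoundaries`, `slabOf`, an even number of slabs of widths `r−1`, `r`) and parity-separation core
(`proj_slab_mem_sympDual_of_parity`) are reused verbatim; the only change is, as printed, cleaning a BARE logical
operator with the subsystem Cleaning Lemma (`sup_gaugeStabilizer_bare_compl_eq`) instead of Lemma 1.

## Mathlib / tree search

Tree: `proj_slab_mem_sympDual_of_parity`, `exists_slabBoundaries`, `slabOf`, `slabOf_mono`, `slabOf_le_succ`,
`slabOf_wrap`, `card_filter_slabOf_le`, `periodic_window_cases` (LocalCodeDistanceBoundPeriodic.lean); `slab`,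
`parityClass`, `compl_parityClass_one`, `eq_sum_proj_slab`, `card_filter_apply_zero_mem` (LocalCodeDistanceBound.lean);
`gaugeStabilizer`, `IsSubsystemCode`, `IsGaugeCorrectable`, `sup_gaugeStabilizer_bare_compl_eq` (SubsystemCodes.lean).
-/

namespace Literature.InformationTheory.QuantumCodes

open Finset Module

variable {n : ℕ}

/-! ### Core under the parity-separation hypothesis, subsystem version -/

section Core

variable (β : Fin n → ℕ) {ι : Type*} (g : ι → SympVec n) {G : Submodule (ZMod 2) (SympVec n)}

/-- (i*′) Under «a stabilizer generator meets at most one slab of each parity»: if no slab supports a dressed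
logical operator, a dressed logical operator supported on one parity class is a gauge operator.
[cite: BravyiTerhal2009, §3.3 proof of Prop. 2 (p. 14) with §2 proof of Prop. 1 (periodic case)] -/
theorem mem_gauge_of_mem_supportedOn_parityClass'
    (hS : gaugeStabilizer G = Submodule.span (ZMod 2) (Set.range g))
    (hsep : ∀ a, ∀ q ∈ sympSupport (g a), ∀ q' ∈ sympSupport (g a), β q % 2 = β q' % 2 → β q = β q')
    (h0 : ∀ j, ∀ Q ∈ sympDual (gaugeStabilizer G), Q ∈ supportedOn (slab β j) → Q ∈ G)
    {p : ℕ} {P : SympVec n} (hPd : P ∈ sympDual (gaugeStabilizer G))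
    (hPs : P ∈ supportedOn (parityClass β p)) : P ∈ G := by
  rw [eq_sum_proj_slab β hPs]
  refine Submodule.sum_mem _ fun j hj => h0 j _ ?_ (proj_mem_supportedOn _ P)
  have hj' : j % 2 = p := (mem_filter.1 hj).2
  rw [hS] at hPd ⊢
  exact proj_slab_mem_sympDual_of_parity β g hsep hPd hPs hj'

/-- (ii*′) **Core of Proposition 2, periodic separation**: `Ḡ⊥ ≤ Ḡ` if no slab supports a dressed logical operator.
[cite: BravyiTerhal2009, §3.3 proof of Prop. 2 (p. 14)] -/
theorem sympDual_gauge_le_of_slabs'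
    (hS : gaugeStabilizer G = Submodule.span (ZMod 2) (Set.range g))
    (hsep : ∀ a, ∀ q ∈ sympSupport (g a), ∀ q' ∈ sympSupport (g a), β q % 2 = β q' % 2 → β q = β q')
    (h0 : ∀ j, ∀ Q ∈ sympDual (gaugeStabilizer G), Q ∈ supportedOn (slab β j) → Q ∈ G) :
    sympDual G ≤ G := by
  intro P hP
  have hU : IsGaugeCorrectable G (parityClass β 1) := fun Q hQ hQs =>
    mem_gauge_of_mem_supportedOn_parityClass' β g hS hsep h0 hQ hQs
  have hP' : P ∈ gaugeStabilizer G ⊔ (sympDual G ⊓ supportedOn (parityClass β 1)ᶜ) := by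
    rw [sup_gaugeStabilizer_bare_compl_eq hU]; exact hP
  obtain ⟨s, hs, q, hq, rfl⟩ := Submodule.mem_sup.1 hP'
  have hqs : q ∈ supportedOn (parityClass β 0) := by rw [← compl_parityClass_one β]; exact hq.2
  have hqd : q ∈ sympDual (gaugeStabilizer G) := sympDual_le_sympDual_gaugeStabilizer G hq.1
  exact G.add_mem (gaugeStabilizer_le G hs) (mem_gauge_of_mem_supportedOn_parityClass' β g hS hsep h0 hqd hqs)

end Core

/-! ### Theorem 1* on the torus -/

/-- **Bravyi–Terhal 2009, Theorem 1* with periodic boundary conditions — proved** (in the generality of Prop. 2):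
on `(ℤ/L)^D`, `D ≥ 1`, `L ≥ 2(r−1)²`, for every gauge space `Ḡ` whose stabilizer space `Ḡ ⊓ Ḡ⊥` is spanned by
elements of it each covered by a hypercube with `r^D` vertices modulo `L` (`r ≥ 1`), with `k ≥ 1` logical qubits
and no dressed logical operator of weight `< d`: `d ≤ r · L^{D−1}`. Column: proved theorem.
[cite: BravyiTerhal2009, §3.3 Prop. 2 («open or periodic boundary conditions … for any L ≥ 2(r−1)²») and Thm. 1* (p. 5)] -/
theorem BravyiTerhal2009_theorem1_star_periodic (D L r : ℕ) {k d : ℕ} (e : Fin n ≃ (Fin D → Fin L))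
    (G : Submodule (ZMod 2) (SympVec n)) (hD : 1 ≤ D) (hr : 1 ≤ r) (hL : 2 * (r - 1) ^ 2 ≤ L)
    (hloc : HasLocalGeneratorsPeriodic e r (gaugeStabilizer G)) (hcode : IsSubsystemCode G k d) (hk : 1 ≤ k) :
    d ≤ r * L ^ (D - 1) := by
  obtain ⟨D', rfl⟩ : ∃ D', D = D' + 1 := ⟨D - 1, by omega⟩
  rw [Nat.add_sub_cancel]
  by_contra hlt
  push Not at hlt
  -- the local generators of the stabilizer space
  set T : Set (SympVec n) := {v | v ∈ gaugeStabilizer G ∧ IsCubeLocalPeriodic e r v} with hT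
  have hS : gaugeStabilizer G = Submodule.span (ZMod 2) (Set.range (Subtype.val : T → SympVec n)) := by
    rw [Subtype.range_coe]
    exact le_antisymm hloc (Submodule.span_le.2 fun v hv => hv.1)
  -- a slab index β: (sep) a generator meets at most one slab of each parity, (card) slabs have ≤ r L^{D'} qubits
  obtain ⟨β, hsep, hcard⟩ : ∃ β : Fin n → ℕ,
      (∀ a : T, ∀ q ∈ sympSupport (a : SympVec n), ∀ q' ∈ sympSupport (a : SympVec n),
        β q % 2 = β q' % 2 → β q = β q') ∧
      (∀ j, #(slab β j) ≤ r * L ^ D') := by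
    rcases Nat.lt_or_ge r 2 with hr1 | hr2
    · -- r = 1: slabs = single columns; a generator lives in one column
      have hr1' : r = 1 := by omega
      subst hr1'
      refine ⟨fun q => ((e q) 0 : ℕ), ?_, ?_⟩
      · intro a q hq q' hq' _
        dsimp only
        obtain ⟨c, hc⟩ := a.2.2
        have h1 := periodic_window_cases (hc q hq 0)
        have h2 := periodic_window_cases (hc q' hq' 0)
        have := ((e q) 0).isLt
        have := ((e q') 0).isLt
        have := (c 0).isLt
        omega
      · intro j
        classical
        have hslab : slab (fun q => ((e q) 0 : ℕ)) j =
            (univ.filter fun x : Fin (D' + 1) → Fin L =>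
              x 0 ∈ (univ.filter fun t : Fin L => (t : ℕ) = j)).map e.symm.toEmbedding := by
          ext q; simp [slab, Finset.mem_map_equiv]
        rw [hslab, Finset.card_map, card_filter_apply_zero_mem, one_mul]
        refine (Nat.mul_le_mul_right _ ?_).trans (le_of_eq (one_mul _))
        rw [Finset.card_le_one]
        intro a ha b hb
        simp only [mem_filter, mem_univ, true_and] at ha hb
        exact Fin.ext (by omega)
    · -- r ≥ 2: balanced partition of the circle into an even number of slabs of widths r-1, r
      obtain ⟨K, t, ht, hKeven, hKpos⟩ :=
        exists_slabBoundaries (u := r - 1) (L := L) (by omega)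
          (by have : 2 * (r - 1) * (r - 1) = 2 * (r - 1) ^ 2 := by ring
              omega)
      refine ⟨fun q => slabOf ht hKpos ((e q) 0 : ℕ), ?_, ?_⟩
      · intro a q hq q' hq' hpar
        dsimp only at hpar ⊢
        obtain ⟨c, hc⟩ := a.2.2
        have h1 := periodic_window_cases (hc q hq 0)
        have h2 := periodic_window_cases (hc q' hq' 0)
        have hx := ((e q) 0).isLt
        have hx' := ((e q') 0).isLt
        have hc₀L := (c 0).isLt
        set x : ℕ := ((e q) 0 : ℕ) with hxdef
        set x' : ℕ := ((e q') 0 : ℕ) with hx'def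
        set c₀ : ℕ := ((c 0 : Fin L) : ℕ) with hc₀
        have hK2 : 2 ≤ K := by omega
        have nowrap : ∀ {y y' : ℕ}, y ≤ y' → y' ≤ y + (r - 1) → y' < L →
            slabOf ht hKpos y % 2 = slabOf ht hKpos y' % 2 → slabOf ht hKpos y = slabOf ht hKpos y' := by
          intro y y' hyy' hy'u hy'L hp
          have a1 := slabOf_mono ht hKpos hyy' hy'L
          have a2 := slabOf_le_succ ht hKpos hyy' hy'u hy'L
          omega
        have wrap : ∀ {y y' : ℕ}, y < L → y' < L → y' + L ≤ y + (r - 1) →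
            slabOf ht hKpos y % 2 ≠ slabOf ht hKpos y' % 2 := by
          intro y y' hyL hy'L hw
          obtain ⟨b1, b2⟩ := slabOf_wrap ht hKpos hyL hy'L hw
          rw [b1, b2]
          omega
        rcases h1 with ⟨h1a, h1b⟩ | ⟨h1a, h1b⟩ <;> rcases h2 with ⟨h2a, h2b⟩ | ⟨h2a, h2b⟩
        · rcases le_total x x' with hle | hle
          · exact nowrap hle (by omega) hx' hpar
          · exact (nowrap hle (by omega) hx hpar.symm).symm
        · exact absurd hpar (wrap hx hx' (by omega))
        · exact absurd hpar.symm (wrap hx' hx (by omega))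
        · rcases le_total x x' with hle | hle
          · exact nowrap hle (by omega) hx' hpar
          · exact (nowrap hle (by omega) hx hpar.symm).symm
      · intro j
        classical
        have hslab : slab (fun q => slabOf ht hKpos ((e q) 0 : ℕ)) j =
            (univ.filter fun x : Fin (D' + 1) → Fin L =>
              x 0 ∈ (univ.filter fun c : Fin L => slabOf ht hKpos c = j)).map e.symm.toEmbedding := by
          ext q; simp [slab, Finset.mem_map_equiv]
        rw [hslab, Finset.card_map, card_filter_apply_zero_mem]
        refine Nat.mul_le_mul_right _ ((card_filter_slabOf_le ht hKpos j).trans (by omega))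
  -- no slab supports a dressed logical operator
  have h0 : ∀ j, ∀ Q ∈ sympDual (gaugeStabilizer G), Q ∈ supportedOn (slab β j) → Q ∈ G := by
    intro j Q hQd hQs
    by_contra hQG
    have h1 := hcode.2 Q hQd hQG
    have h2 := sympWeight_le_card_of_mem hQs
    have h3 := hcard j
    omega
  -- hence Ḡ⊥ ≤ Ḡ: no logical qubits
  have hle : sympDual G ≤ G := sympDual_gauge_le_of_slabs' β _ hS hsep h0
  have hSe : gaugeStabilizer G = sympDual G := inf_eq_right.2 hle
  have hdim := hcode.1
  rw [hSe] at hdim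
  omega

end Literature.InformationTheory.QuantumCodes
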